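import Summits.QuantumFields.YangMills.Theorems.BalabanUVNodesPortS1Frame
import Summits.QuantumFields.YangMills.Theorems.BalabanUVNodesPortU8TwoVolume

/-!
# NODE O port PT-A, [RG-I] (1.7) p. 261 with (1.21) p. 264 — ROWS (c) AND (e) «BY CONSTRUCTION» for pieces given by a WINDOW-LOCAL INTEGER FORMULA:
# the centred two-volume geometry on the exactly tiled range (integer cube indices and fine sites read through `ZMod.valMinAbs`), and the theorem that
# pieces ON PAIRS of the form `Ep X φ = Ψ (X̂) (φ pulled back to ℤ⁴-bonds)` — ONE formula `Ψ` for every volume — satisfy (1.7) locality and the two-volume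
# identity of the (S1) mould at the record names

Cell `ym-nodeO-ideate`, porter seat `ymgap-nodeO-port-PTA-1` (gen 2); `--supports stmt-QuantumFields-27930`; PORT-PLAN v1 §1 row (e) («OURS (implicit in (1.21)): the
localized pieces of a domain not meeting the seam are the same function of the pair in `T_K` and `T_{K+1}` — holds BY CONSTRUCTION once the pieces are defined by
volume-independent local formulas») and row (c).  [I] = [Balaban1987RG1].  Print (1.7) p. 261: «the term corresponding to a domain X depends on U_j restricted to
X»; (1.21) p. 264: the limit «T^{(j+1)} ↗ Z^d» «exists by the localized representation (1.7)» — i.e. a piece of a domain `X` is ONE function of the configuration on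
`X`, whichever torus `X` sits in.  Every piece [I] §3–§5 ∕ [II] ∕ [16] (63) construct IS of this form (finite sums over walks ∕ polymers inside `X` of products of
bond variables of `(𝐔, 𝐉)|_X`); this file proves the two format rows for the form, once.

THE FORM (hypotheses, no definition): `Ψ : Finset (ℤ⁴) → ((ℤ⁴ × Fin 4) → M₂(ℂ) × M₂(ℂ)) → ℂ` — a function of a finite set `X̂` of INTEGER cube indices and of an
integer-bond configuration — LOCAL: `Ψ X̂ f` depends on `f` only at the integer bonds `(z, μ)` with `z` and `z + e_μ` in the integer sites `⋃_{ĉ ∈ X̂} [s ĉ, s ĉ + s)⁴` of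
`X̂` (`s = L^{k+1}·Mc` the cube side in fine sites); and the pieces at volume `K` are `Ep X φ = Ψ X̂_K(X) (φ ∘ cover_K)`, `X̂_K(X)` = the `valMinAbs`-representatives of the
cube indices of `X`, `cover_K : ℤ⁴ → T_K` the universal cover (`B15Eq112TorusCover.cover`).

CONTENTS.  §1 the exactly tiled range (`recordK₀ F Mc k ≤ K`, `McGuard F Mc`): cube side, `N_K = q_K · s` (integer form), `q_K ≤ q_{K+1}` (porter PTB-1's `PortU8.domCount_succ_vol`, reused); §2 the centred readings: `valMinAbs` of a
centred-lifted cube index is unchanged, hence ★ `image_valMinAbs_recordDomEmbCtr` — OFF THE WRAP CLASS the embedded domain has the SAME integer cube set; §3 the window: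
the integer sites of an off-seam cube satisfy `2|z_i| < N_K`, and on that window the centred site∕bond lift IS the change of cover (`liftSiteCtr_cover`, `liftBondCtr_cover`);
`cover` intertwines `+e_μ` with `Site.shift`; the integer sites of `X̂_K(X)` cover INTO `Sect2.domSites X`; §4 ★★ `local17_cpair_of_intLocalFormula` (row (c)) and
★★ `pieceVolIndep_cpair_of_intLocalFormula` (row (e), in the exact hypothesis shape `hV` of `formatPlusG_record_of_cpairRowsCtr(_add)`).

HONEST FRAMING.  Torus∕integer bookkeeping; no piece of Bałaban's is constructed here and nothing of [I] §2–§5 is ported or discharged; 27930 OPEN; K0⁷ NOT closed;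
NODE O 0∕1; COUNT 8∕28 · K 1∕4 UNMOVED; finite `𝕋⁴_{L^K}` at fixed ε — NOT continuum ∕ OS ∕ Clay; **the Yang–Mills mass gap is NOT proved by any of this.**
No `sorry`, no `def`, no `instance`; standard axioms.

v2 (same seat, APPEND-ONLY; §1–§4 byte-identical to ✓p797417): §5 ROW (d) — (1.19) gauge invariance BY CONSTRUCTION for integer-local formulas invariant under the
pulled-back (1.10) action (`pull_cAct_eq`, ★★ `gaugeInv119_cpair_of_intLocalFormula`).  Same honest framing.

v3 (same seat, APPEND-ONLY; §1–§5 byte-identical to ✓p797450): §6 ROW (a)∕(b) PLUMBING — a pull-back piece whose formula factors through FINITELY many integer bonds is analytic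
at a pair as soon as the finite formula is analytic at the restricted pull-back (`exists_pullRestrictCLM`, ★ `analyticAt_cpair_of_finiteFormula`, `norm_cpair_of_finiteFormula`).
-/

noncomputable section

open scoped BigOperators Matrix.Norms.L2Operator

namespace Summit.QuantumFields.YangMills.Theorems.BalabanUVNodesPortS1

open Summit.QuantumFields.YangMills.Theorems.K0RecordFormatNames
open Literature.MathematicalPhysics.QuantumFieldTheory.Balaban1983to89
open Literature.MathematicalPhysics.QuantumFieldTheory.Balaban1983to89.Node00
open Literature.MathematicalPhysics.QuantumFieldTheory.Balaban1983to89.T4Continuum (T4Family)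
open Literature.MathematicalPhysics.QuantumFieldTheory.Balaban1983to89.B15Eq112TorusCover (cover)
open Literature.MathematicalPhysics.QuantumFieldTheory.Balaban1983to89.B14.Eq213MaximalDomains (cubeExt side)
open Literature.MathematicalPhysics.QuantumFieldTheory.Balaban1983to89.TreeLengthTorus (TPt)

variable (F : T4Family)

/-! ## §1  The exactly tiled range: cube side, `N_K = q_K · s`, `q_K ≤ q_{K+1}` -/

/-- The cube side of `𝐃_{k+1}` in fine sites is `s = L^{k+1} · Mc`, the same on every torus of the family. [cite: Balaban1987RG1, p.257 (the cubes π_j)] -/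
theorem side_record (Mc k K : ℕ) : side (F.P K).L Mc (k + 1) = F.L ^ (k + 1) * Mc := rfl

/-- The cube side is positive for an admissible `Mc = L^c`. [cite: Balaban1987RG1, p.257 (bookkeeping)] -/
theorem side_record_pos {Mc : ℕ} (hMc : McGuard F Mc) (k : ℕ) : 0 < F.L ^ (k + 1) * Mc := by
  obtain ⟨c, rfl⟩ := hMc
  have hL : 0 < F.L := by have := F.hL.2; omega
  positivity

variable {F} in
/-- **`N_K = q_K · s`** on the exactly tiled range (integer form of `domCount_mul_side_eq`). [cite: Balaban1987RG1, p.257 (the cubes π_j tile the torus)] -/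
theorem sitesPerDir_eq_domCount_mul_side_int {Mc k K : ℕ} (hMc : McGuard F Mc) (hK : recordK₀ F Mc k ≤ K) :
    (((F.P K).sitesPerDir 0 : ℕ) : ℤ) = (Sect2.domCount (F.P K) Mc (k + 1) : ℤ) * ((F.L ^ (k + 1) * Mc : ℕ) : ℤ) := by
  have h := domCount_mul_side_eq hMc hK
  exact_mod_cast h.symm

variable {F} in
/-- `q_K ≤ q_{K+1}` on the exactly tiled range. [cite: Balaban1987RG1, (1.21) p.264 (bookkeeping)] -/
theorem domCount_le_succ {Mc k K : ℕ} (hMc : McGuard F Mc) (hK : recordK₀ F Mc k ≤ K) :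
    Sect2.domCount (F.P K) Mc (k + 1) ≤ Sect2.domCount (F.P (K + 1)) Mc (k + 1) := by
  rw [PortU8.domCount_succ_vol hMc hK]
  exact Nat.le_mul_of_pos_left _ (by have := F.hL.2; omega)

/-! ## §2  The centred readings: `valMinAbs` of a lifted cube index; the embedded domain has the same integer cube set -/

variable {F} in
/-- **The centred cube lift does not change the integer representative**: `valMinAbs ((liftCubeCtr c) i) = valMinAbs (c i)` (the representative of `ZMod q` lies in
the `valMinAbs`-window of the larger modulus `q' ≥ q`). [cite: Balaban1987RG1, (1.21) p.264] -/
theorem valMinAbs_liftCubeCtr {Mc k K : ℕ} (hMc : McGuard F Mc) (hK : recordK₀ F Mc k ≤ K)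
    (c : TPt (F.P K).d (Sect2.domCount (F.P K) Mc (k + 1))) (i : Fin (F.P (K + 1)).d) :
    (liftCubeCtr F Mc k K c i).valMinAbs = (c i).valMinAbs := by
  haveI : NeZero (Sect2.domCount (F.P K) Mc (k + 1)) := ⟨Nat.succ_ne_zero _⟩
  haveI : NeZero (Sect2.domCount (F.P (K + 1)) Mc (k + 1)) := ⟨Nat.succ_ne_zero _⟩
  have hle : (Sect2.domCount (F.P K) Mc (k + 1) : ℤ) ≤ Sect2.domCount (F.P (K + 1)) Mc (k + 1) := by
    exact_mod_cast domCount_le_succ hMc hK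
  have hm := (c i).valMinAbs_mem_Ioc
  rw [Set.mem_Ioc] at hm
  simp only [liftCubeCtr]
  rw [ZMod.valMinAbs_spec]
  exact ⟨rfl, Set.mem_Ioc.2 ⟨by linarith, by linarith⟩⟩

variable {F} in
/-- ★ **OFF THE WRAP CLASS THE EMBEDDED DOMAIN HAS THE SAME INTEGER CUBE SET**: the `valMinAbs`-representatives of the cube indices of `recordDomEmbCtr X` are those of `X`.
[cite: Balaban1987RG1, (1.21) p.264, (1.7) p.261] -/
theorem image_valMinAbs_recordDomEmbCtr {Mc k K : ℕ} (hMc : McGuard F Mc) (hK : recordK₀ F Mc k ≤ K)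
    (X : (recordDomSys F Mc k K).Dom) (hX : X ∉ recordWrapCtr F Mc k K) :
    (((recordDomEmbCtr F Mc k K X).1 : Finset _).image (fun c (i : Fin 4) => (c i).valMinAbs) : Finset (Fin 4 → ℤ)) =
      (X.1 : Finset _).image (fun c (i : Fin 4) => (c i).valMinAbs) := by
  classical
  rw [recordDomEmbCtr_val_of_not_mem F Mc k K X hX, Finset.image_image]
  refine Finset.image_congr fun c _ => ?_
  funext i
  exact valMinAbs_liftCubeCtr hMc hK c i

/-! ## §3  The window of an off-seam cube; the centred lift on the window is the change of cover; cover and `+e_μ`; integer sites cover into `domSites` -/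

variable {F} in
/-- **The integer sites of an OFF-SEAM cube lie in the centred window**: for `c` with no coordinate at the antipodal value and `z` in the `s`-cube of integer
index `valMinAbs ∘ c`, `2|z_i| < N_K` in every direction (exact tiling `N_K = q_K s`). [cite: Balaban1987RG1, (1.21) p.264] -/
theorem two_mul_abs_lt_of_mem_cubeExt_valMinAbs {Mc k K : ℕ} (hMc : McGuard F Mc) (hK : recordK₀ F Mc k ≤ K)
    (c : TPt (F.P K).d (Sect2.domCount (F.P K) Mc (k + 1))) (hc : ¬ OnSeamCtr c)
    {z : Fin (F.P K).d → ℤ} (hz : z ∈ cubeExt (F.L ^ (k + 1) * Mc) (fun i => (c i).valMinAbs) 0) (i : Fin (F.P K).d) :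
    2 * |z i| < (((F.P K).sitesPerDir 0 : ℕ) : ℤ) := by
  haveI : NeZero (Sect2.domCount (F.P K) Mc (k + 1)) := ⟨Nat.succ_ne_zero _⟩
  rw [sitesPerDir_eq_domCount_mul_side_int hMc hK]
  have hs : (0 : ℤ) < ((F.L ^ (k + 1) * Mc : ℕ) : ℤ) := by exact_mod_cast side_record_pos F hMc k
  have hm := (c i).valMinAbs_mem_Ioc
  rw [Set.mem_Ioc] at hm
  have hne : (c i).valMinAbs ≠ ((Sect2.domCount (F.P K) Mc (k + 1) / 2 : ℕ) : ℤ) := (not_onSeamCtr_iff c).1 hc i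
  have hqh : ((Sect2.domCount (F.P K) Mc (k + 1) / 2 : ℕ) : ℤ) * 2 ≤ (Sect2.domCount (F.P K) Mc (k + 1) : ℤ) := by
    have : (Sect2.domCount (F.P K) Mc (k + 1) / 2) * 2 ≤ Sect2.domCount (F.P K) Mc (k + 1) := Nat.div_mul_le_self _ 2
    exact_mod_cast this
  have hqh' : (Sect2.domCount (F.P K) Mc (k + 1) : ℤ) ≤ ((Sect2.domCount (F.P K) Mc (k + 1) / 2 : ℕ) : ℤ) * 2 + 1 := by
    have : Sect2.domCount (F.P K) Mc (k + 1) ≤ (Sect2.domCount (F.P K) Mc (k + 1) / 2) * 2 + 1 := by omega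
    exact_mod_cast this
  obtain ⟨hz1, hz2⟩ := hz i
  simp only [sub_zero, add_zero] at hz1 hz2
  -- abbreviate the letters (no `set`: `c`'s type mentions the cube count)
  generalize hsv : ((F.L ^ (k + 1) * Mc : ℕ) : ℤ) = s at hs hz1 hz2 ⊢
  generalize hhv : ((Sect2.domCount (F.P K) Mc (k + 1) / 2 : ℕ) : ℤ) = h at hne hqh hqh'
  generalize hqv : (Sect2.domCount (F.P K) Mc (k + 1) : ℤ) = q at hm hqh hqh' ⊢
  generalize hvv : (c i).valMinAbs = v at hm hne hz1 hz2
  by_cases h0 : 0 ≤ v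
  · -- `0 ≤ v ≤ h − 1`
    have hvh : v ≤ h - 1 := by omega
    have hzv : s * v ≤ s * (h - 1) := mul_le_mul_of_nonneg_left hvh hs.le
    have hsq : s * (h * 2) ≤ s * q := mul_le_mul_of_nonneg_left hqh hs.le
    have hz0 : 0 ≤ z i := le_trans (mul_nonneg hs.le h0) hz1
    rw [abs_of_nonneg hz0]
    linarith
  · -- `v < 0`: `|z| ≤ s|v|`, `2|v| < q`
    have h0' : v ≤ -1 := by omega
    have hzneg : z i < 0 := by
      have : s * v ≤ s * (-1) := mul_le_mul_of_nonneg_left h0' hs.le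
      linarith
    rw [abs_of_neg hzneg]
    have h3 : s * (-(v * 2)) ≤ s * (q - 1) := mul_le_mul_of_nonneg_left (by omega) hs.le
    linarith

/-- **On the centred window the centred site lift IS the change of cover**: `liftSiteCtr (cover_K z) = cover_{K+1} z` for `2|z_i| < N_K`.
[cite: Balaban1987RG1, (1.21) p.264] -/
theorem liftSiteCtr_cover (K : ℕ) (z : Fin (F.P K).d → ℤ) (hz : ∀ i, 2 * |z i| < (((F.P K).sitesPerDir 0 : ℕ) : ℤ)) :
    liftSiteCtr F K 0 (cover (F.P K) z) = cover (F.P (K + 1)) z := by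
  funext μ
  simp only [liftSiteCtr, cover]
  have h : (((z μ : ℤ) : ZMod ((F.P K).sitesPerDir 0))).valMinAbs = z μ := by
    rw [ZMod.valMinAbs_spec]
    have hzμ := hz μ
    have h1 := neg_abs_le (z μ)
    have h2 := le_abs_self (z μ)
    exact ⟨rfl, Set.mem_Ioc.2 ⟨by linarith, by linarith⟩⟩
  rw [h]

/-- The bond form: `liftBondCtr ⟨cover_K z, μ⟩ = ⟨cover_{K+1} z, μ⟩` on the window. [cite: Balaban1987RG1, (1.21) p.264] -/
theorem liftBondCtr_cover (K : ℕ) (z : Fin (F.P K).d → ℤ) (μ : Fin (F.P K).d) (hz : ∀ i, 2 * |z i| < (((F.P K).sitesPerDir 0 : ℕ) : ℤ)) :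
    liftBondCtr F K 0 ⟨cover (F.P K) z, μ⟩ = ⟨cover (F.P (K + 1)) z, μ⟩ := by
  simp only [liftBondCtr, liftSiteCtr_cover F K z hz]

/-- **`cover` intertwines the integer step `z ↦ z + e_μ` with `Site.shift`.** [cite: Balaban1987RG1, (0.1) p.251 (bookkeeping)] -/
theorem cover_update_add_one (P : Params) (z : Fin P.d → ℤ) (μ : Fin P.d) :
    cover P (Function.update z μ (z μ + 1)) = (cover P z).shift μ := by
  funext ν
  simp only [cover, Site.shift]
  by_cases h : ν = μ
  · subst h
    simp [Function.update_self]
  · simp [Function.update_of_ne h]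

/-- The target of the bond `⟨cover z, μ⟩` is `cover (z + e_μ)`. [cite: Balaban1987RG1, (0.1) p.251 (bookkeeping)] -/
theorem tgt_cover (P : Params) (z : Fin P.d → ℤ) (μ : Fin P.d) :
    (⟨cover P z, μ⟩ : PBond P 0).tgt = cover P (Function.update z μ (z μ + 1)) := by
  rw [PBond.tgt, cover_update_add_one]

variable {F} in
/-- **The integer sites of `X̂_K(X)` cover INTO the fine sites of `X`**: for a cube index `c` of `X` and `z` in the `s`-cube of integer index `valMinAbs ∘ c`,
`cover_K z ∈ Sect2.domSites X` (the `val`- and `valMinAbs`-representatives of `c` differ by multiples of `q`, i.e. the integer cubes by multiples of `N_K = q s`,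
invisible to `cover_K`). [cite: Balaban1987RG1, p.257, (1.7) p.261] -/
theorem cover_mem_domSites_of_mem_cubeExt_valMinAbs {Mc k K : ℕ} (hMc : McGuard F Mc) (hK : recordK₀ F Mc k ≤ K)
    {X : (recordDomSys F Mc k K).Dom} {c : TPt (F.P K).d (Sect2.domCount (F.P K) Mc (k + 1))} (hc : c ∈ (X.1 : Finset _))
    {z : Fin (F.P K).d → ℤ} (hz : z ∈ cubeExt (F.L ^ (k + 1) * Mc) (fun i => (c i).valMinAbs) 0) :
    cover (F.P K) z ∈ Sect2.domSites (F.P K) Mc (k + 1) X := by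
  classical
  -- the shift to the `val`-representative: `z' := z + s · (val − valMinAbs)` coordinatewise
  have hz'mem : (fun i => z i + ((F.L ^ (k + 1) * Mc : ℕ) : ℤ) * ((((c i).val : ℕ) : ℤ) - (c i).valMinAbs)) ∈
      cubeExt (F.L ^ (k + 1) * Mc) (Sect2.liftIdx (F.P K) c) 0 := by
    intro i
    obtain ⟨h1, h2⟩ := hz i
    simp only [Sect2.liftIdx, sub_zero, add_zero] at h1 h2 ⊢
    constructor <;> nlinarith
  have hcov : cover (F.P K) (fun i => z i + ((F.L ^ (k + 1) * Mc : ℕ) : ℤ) * ((((c i).val : ℕ) : ℤ) - (c i).valMinAbs)) =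
      cover (F.P K) z := by
    funext i
    simp only [cover]
    have hdvd : ((Sect2.domCount (F.P K) Mc (k + 1) : ℕ) : ℤ) ∣ (((c i).val : ℕ) : ℤ) - (c i).valMinAbs := by
      rw [← ZMod.intCast_eq_intCast_iff_dvd_sub, ZMod.coe_valMinAbs]
      simp
    have hN : (((F.P K).sitesPerDir 0 : ℕ) : ℤ) ∣ ((F.L ^ (k + 1) * Mc : ℕ) : ℤ) * ((((c i).val : ℕ) : ℤ) - (c i).valMinAbs) := by
      rw [sitesPerDir_eq_domCount_mul_side_int hMc hK, mul_comm]
      exact mul_dvd_mul_left _ hdvd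
    rw [Int.cast_add, (ZMod.intCast_zmod_eq_zero_iff_dvd _ _).2 hN, add_zero]
  rw [Sect2.domSites, Set.mem_iUnion₂]
  refine ⟨c, hc, ?_⟩
  show cover (F.P K) z ∈ cover (F.P K) '' cubeExt (side (F.P K).L Mc (k + 1)) (Sect2.liftIdx (F.P K) c) ((0 * side (F.P K).L Mc (k + 1) : ℕ) : ℤ)
  rw [Nat.zero_mul, Nat.cast_zero, side_record]
  exact ⟨_, hz'mem, hcov⟩

/-! ## §4  ★★ ROWS (c) AND (e) FOR PIECES GIVEN BY A WINDOW-LOCAL INTEGER FORMULA -/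

variable {F} in
/-- ★★ **ROW (c) — (1.7) LOCALITY BY CONSTRUCTION.**  If the pieces on pairs at volume `K` (exactly tiled range) are `Ep X φ = Ψ X̂_K(X) (φ ∘ cover_K)` for ONE formula `Ψ`
reading its configuration argument only at integer bonds with both endpoints in the integer sites of `X̂`, then pairs agreeing on the sites of `X` give the same piece
(hypothesis `hL` of `formatPlusG_record_of_cpairRowsCtr(_add)` at one volume). [cite: Balaban1987RG1, (1.7) p.261, p.263 («depends on (𝐔, 𝐉)|_X»)] -/
theorem local17_cpair_of_intLocalFormula {Mc k K : ℕ} (hMc : McGuard F Mc) (hK : recordK₀ F Mc k ≤ K)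
    (Ψ : Finset (Fin 4 → ℤ) → (((Fin 4 → ℤ) × Fin 4) → MatA 2 × MatA 2) → ℂ)
    (hΨ : ∀ (Xh : Finset (Fin 4 → ℤ)) (f g : ((Fin 4 → ℤ) × Fin 4) → MatA 2 × MatA 2),
      (∀ zμ : (Fin 4 → ℤ) × Fin 4,
        zμ.1 ∈ (⋃ a ∈ Xh, cubeExt (F.L ^ (k + 1) * Mc) a 0) →
        Function.update zμ.1 zμ.2 (zμ.1 zμ.2 + 1) ∈ (⋃ a ∈ Xh, cubeExt (F.L ^ (k + 1) * Mc) a 0) → f zμ = g zμ) →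
      Ψ Xh f = Ψ Xh g)
    (EpK : (recordDomSys F Mc k K).Dom → Sect2.CPair (F.P K) (MatA 2) → ℂ)
    (hEp : ∀ X φ, EpK X φ = Ψ ((X.1 : Finset _).image (fun c (i : Fin 4) => (c i).valMinAbs))
      (fun zμ => (φ.1 ⟨cover (F.P K) zμ.1, zμ.2⟩, φ.2 ⟨cover (F.P K) zμ.1, zμ.2⟩))) :
    ∀ X φ ψ, Sect2.agreeOnSet (Sect2.domSites (F.P K) Mc (k + 1) X) φ ψ → EpK X φ = EpK X ψ := by
  classical
  intro X φ ψ hag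
  rw [hEp, hEp]
  refine hΨ _ _ _ fun zμ hz hzt => ?_
  obtain ⟨a, ha, hza⟩ := Set.mem_iUnion₂.1 hz
  obtain ⟨a', ha', hza'⟩ := Set.mem_iUnion₂.1 hzt
  obtain ⟨c, hc, rfl⟩ := Finset.mem_image.1 ha
  obtain ⟨c', hc', rfl⟩ := Finset.mem_image.1 ha'
  have h1 : cover (F.P K) zμ.1 ∈ Sect2.domSites (F.P K) Mc (k + 1) X := cover_mem_domSites_of_mem_cubeExt_valMinAbs hMc hK hc hza
  have h2 : (⟨cover (F.P K) zμ.1, zμ.2⟩ : PBond (F.P K) 0).tgt ∈ Sect2.domSites (F.P K) Mc (k + 1) X := by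
    rw [tgt_cover]
    exact cover_mem_domSites_of_mem_cubeExt_valMinAbs hMc hK hc' hza'
  obtain ⟨e1, e2⟩ := hag ⟨cover (F.P K) zμ.1, zμ.2⟩ h1 h2
  exact Prod.ext e1 e2

variable {F} in
/-- ★★ **ROW (e) — THE TWO-VOLUME IDENTITY BY CONSTRUCTION.**  If, at EVERY volume `K₀ + n` of the text (`recordK₀ F Mc k ≤ K₀`, `Mc` admissible), the pieces on pairs are
`Ep n X φ = Ψ X̂_{K₀+n}(X) (φ ∘ cover_{K₀+n})` for ONE window-local formula `Ψ`, then for every domain `X` OFF the centred wrap class the piece of the embedded domain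
`recordDomEmbCtr X` at volume `K₀ + n + 1` IS the piece of `X` at volume `K₀ + n` composed with the centred window restriction of pairs — hypothesis `hV` of
`formatPlusG_record_of_cpairRowsCtr(_add)` verbatim.  (Off the seam: same integer cube set, §2; the bonds `Ψ` reads lie in the window where `liftBondCtr ∘ cover_K = cover_{K+1}`, §3.)
[cite: Balaban1987RG1, (1.7) p.261 with (1.21) p.264] -/
theorem pieceVolIndep_cpair_of_intLocalFormula (Mc k K₀ : ℕ) (hMc : McGuard F Mc) (hK₀ : recordK₀ F Mc k ≤ K₀)
    (Ψ : Finset (Fin 4 → ℤ) → (((Fin 4 → ℤ) × Fin 4) → MatA 2 × MatA 2) → ℂ)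
    (hΨ : ∀ (Xh : Finset (Fin 4 → ℤ)) (f g : ((Fin 4 → ℤ) × Fin 4) → MatA 2 × MatA 2),
      (∀ zμ : (Fin 4 → ℤ) × Fin 4,
        zμ.1 ∈ (⋃ a ∈ Xh, cubeExt (F.L ^ (k + 1) * Mc) a 0) →
        Function.update zμ.1 zμ.2 (zμ.1 zμ.2 + 1) ∈ (⋃ a ∈ Xh, cubeExt (F.L ^ (k + 1) * Mc) a 0) → f zμ = g zμ) →
      Ψ Xh f = Ψ Xh g)
    (Ep : (n : ℕ) → (recordDomSys F Mc k (K₀ + n)).Dom → Sect2.CPair (F.P (K₀ + n)) (MatA 2) → ℂ)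
    (hEp : ∀ n X φ, Ep n X φ = Ψ ((X.1 : Finset _).image (fun c (i : Fin 4) => (c i).valMinAbs))
      (fun zμ => (φ.1 ⟨cover (F.P (K₀ + n)) zμ.1, zμ.2⟩, φ.2 ⟨cover (F.P (K₀ + n)) zμ.1, zμ.2⟩))) :
    ∀ n X, X ∉ recordWrapCtr F Mc k (K₀ + n) → ∀ φ' : Sect2.CPair (F.P (K₀ + n + 1)) (MatA 2),
      Ep (n + 1) (recordDomEmbCtr F Mc k (K₀ + n) X) φ' =
        Ep n X (fun b => φ'.1 (liftBondCtr F (K₀ + n) 0 b), fun b => φ'.2 (liftBondCtr F (K₀ + n) 0 b)) := by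
  classical
  intro n X hX φ'
  have hK : recordK₀ F Mc k ≤ K₀ + n := hK₀.trans (Nat.le_add_right _ _)
  rw [hEp (n + 1), hEp n]
  refine (congrArg₂ Ψ (image_valMinAbs_recordDomEmbCtr hMc hK X hX) rfl).trans (hΨ _ _ _ fun zμ hz _ => ?_)
  obtain ⟨a, ha, hza⟩ := Set.mem_iUnion₂.1 hz
  obtain ⟨c, hc, rfl⟩ := Finset.mem_image.1 ha
  have hcs : ¬ OnSeamCtr c := fun hs => hX ((mem_recordWrapCtr_iff F Mc k (K₀ + n) X).2 ⟨c, hc, hs⟩)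
  have hwin : ∀ i, 2 * |zμ.1 i| < (((F.P (K₀ + n)).sitesPerDir 0 : ℕ) : ℤ) :=
    two_mul_abs_lt_of_mem_cubeExt_valMinAbs hMc hK c hcs hza
  show (φ'.1 ⟨cover (F.P (K₀ + n + 1)) zμ.1, zμ.2⟩, φ'.2 ⟨cover (F.P (K₀ + n + 1)) zμ.1, zμ.2⟩) =
    (φ'.1 (liftBondCtr F (K₀ + n) 0 ⟨cover (F.P (K₀ + n)) zμ.1, zμ.2⟩), φ'.2 (liftBondCtr F (K₀ + n) 0 ⟨cover (F.P (K₀ + n)) zμ.1, zμ.2⟩))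
  rw [liftBondCtr_cover F (K₀ + n) zμ.1 zμ.2 hwin]

/-! ## §5  (v2 APPEND) ROW (d) — (1.19) GAUGE INVARIANCE BY CONSTRUCTION for integer-local formulas invariant under the pulled-back (1.10) action -/

variable {F} in
/-- **The (1.10) action pulled back to integer bonds**: for a `Gᶜ`-valued gauge transformation `u` of the fine torus, the pull-back of `(𝐔, 𝐉)^u` along `cover_K` is the
integer (1.10) action of `û := u ∘ cover_K` on the pull-back of `(𝐔, 𝐉)`: `(û(z) 𝐔 û(z + e_μ)⁻¹, û(z) 𝐉 û(z)⁻¹)` at the bond `(z, μ)`. [cite: Balaban1987RG1, (1.10) p.262] -/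
theorem pull_cAct_eq (K : ℕ) (u : Site (F.P K) 0 → (MatA 2)ˣ) (φ : Sect2.CPair (F.P K) (MatA 2)) :
    (fun zμ : (Fin 4 → ℤ) × Fin 4 =>
        ((Sect2.cAct u φ).1 ⟨cover (F.P K) zμ.1, zμ.2⟩, (Sect2.cAct u φ).2 ⟨cover (F.P K) zμ.1, zμ.2⟩)) =
      fun zμ => ((u (cover (F.P K) zμ.1) : MatA 2) * φ.1 ⟨cover (F.P K) zμ.1, zμ.2⟩ *
          ((u (cover (F.P K) (Function.update zμ.1 zμ.2 (zμ.1 zμ.2 + 1))))⁻¹ : (MatA 2)ˣ),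
        (u (cover (F.P K) zμ.1) : MatA 2) * φ.2 ⟨cover (F.P K) zμ.1, zμ.2⟩ * ((u (cover (F.P K) zμ.1))⁻¹ : (MatA 2)ˣ)) := by
  funext zμ
  simp only [Sect2.cAct, tgt_cover]

variable {F} in
/-- ★★ **ROW (d) — (1.19) GAUGE INVARIANCE BY CONSTRUCTION.**  If the pieces on pairs at volume `K` are `Ep X φ = Ψ X̂_K(X) (φ ∘ cover_K)` and the formula `Ψ` is invariant under
the integer (1.10) action of every `Gᶜ = SL(2, ℂ)`-valued integer gauge transformation `û : ℤ⁴ → M₂(ℂ)ˣ`, then `Ep X ((𝐔, 𝐉)^u) = Ep X (𝐔, 𝐉)` for every `Gᶜ`-valued `u` of the fine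
torus — hypothesis `hG` of `formatPlusG_record_of_cpairRowsCtr(_add)` at one volume (take `û := u ∘ cover_K`). [cite: Balaban1987RG1, (1.19) p.263, (1.10) p.262] -/
theorem gaugeInv119_cpair_of_intLocalFormula {Mc k K : ℕ}
    (Ψ : Finset (Fin 4 → ℤ) → (((Fin 4 → ℤ) × Fin 4) → MatA 2 × MatA 2) → ℂ)
    (hΨG : ∀ (Xh : Finset (Fin 4 → ℤ)) (û : (Fin 4 → ℤ) → (MatA 2)ˣ),
      (∀ z, û z ∈ (B12RegularSpaces111SpecialUnitary.suModel 2).Gc) →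
      ∀ f : ((Fin 4 → ℤ) × Fin 4) → MatA 2 × MatA 2,
        Ψ Xh (fun zμ => ((û zμ.1 : MatA 2) * (f zμ).1 * ((û (Function.update zμ.1 zμ.2 (zμ.1 zμ.2 + 1)))⁻¹ : (MatA 2)ˣ),
          (û zμ.1 : MatA 2) * (f zμ).2 * ((û zμ.1)⁻¹ : (MatA 2)ˣ))) = Ψ Xh f)
    (EpK : (recordDomSys F Mc k K).Dom → Sect2.CPair (F.P K) (MatA 2) → ℂ)
    (hEp : ∀ X φ, EpK X φ = Ψ ((X.1 : Finset _).image (fun c (i : Fin 4) => (c i).valMinAbs))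
      (fun zμ => (φ.1 ⟨cover (F.P K) zμ.1, zμ.2⟩, φ.2 ⟨cover (F.P K) zμ.1, zμ.2⟩))) :
    ∀ X (u : recordGaugeGrp F K) φ, EpK X (Sect2.cAct u.1 φ) = EpK X φ := by
  intro X u φ
  rw [hEp, hEp, pull_cAct_eq]
  exact hΨG _ (fun z => u.1 (cover (F.P K) z)) (fun z => u.2 _)
    (fun zμ => (φ.1 ⟨cover (F.P K) zμ.1, zμ.2⟩, φ.2 ⟨cover (F.P K) zμ.1, zμ.2⟩))

/-! ## §6  (v3 APPEND) ROW (a) PLUMBING — analyticity of a pull-back piece from analyticity of a FINITE formula: if `Ψ X̂` factors through the restriction to a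
finite set `S` of integer bonds, `Ψ X̂ f = Ψ′ (f|_S)`, and `Ψ′` is analytic at the restricted pull-back of the pair `φ`, then the piece `ψ ↦ Ψ X̂ (ψ ∘ cover_K)` is analytic at `φ`
(composition with the continuous linear restriction `Sect2.CPair → (S → M₂(ℂ) × M₂(ℂ))`) -/

/-- **The restricted pull-back `Sect2.CPair → (S → M₂(ℂ) × M₂(ℂ))`, `ψ ↦ (s ↦ (𝐔(cover s), 𝐉(cover s)))`, is (the function of) a continuous `ℂ`-linear map.**
[cite: Balaban1987RG1, (1.9) p.262 (bookkeeping)] -/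
theorem exists_pullRestrictCLM (K : ℕ) (S : Finset ((Fin 4 → ℤ) × Fin 4)) :
    ∃ R : Sect2.CPair (F.P K) (MatA 2) →L[ℂ] (↥S → MatA 2 × MatA 2),
      ∀ ψ, R ψ = fun s : S => (ψ.1 ⟨cover (F.P K) s.1.1, s.1.2⟩, ψ.2 ⟨cover (F.P K) s.1.1, s.1.2⟩) := by
  let Rlin : Sect2.CPair (F.P K) (MatA 2) →ₗ[ℂ] (↥S → MatA 2 × MatA 2) :=
    { toFun := fun ψ s => (ψ.1 ⟨cover (F.P K) s.1.1, s.1.2⟩, ψ.2 ⟨cover (F.P K) s.1.1, s.1.2⟩)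
      map_add' := fun ψ ψ' => by funext s; rfl
      map_smul' := fun c ψ => by funext s; rfl }
  exact ⟨LinearMap.toContinuousLinearMap Rlin, fun _ => rfl⟩

/-- ★ **ROW (a) PLUMBING.**  If the formula at `X̂` factors through a finite set `S` of integer bonds (`Ψ X̂ f = Ψ′ (f|_S)`) and `Ψ′` is analytic at the restricted pull-back of
`φ`, then the pull-back piece `ψ ↦ Ψ X̂ (ψ ∘ cover_K)` is analytic at `φ` — hypothesis `hA` of `formatPlusG_record_of_cpairRowsCtr(_add)` ∕ of the residue, reduced to the
analyticity of a function of FINITELY MANY matrix variables (print's «analytic functions of the configurations restricted to X»).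
[cite: Balaban1987RG1, (1.9) p.261, p.263 («defined and analytic on the space U^c_j(X, α₀, α₁)»)] -/
theorem analyticAt_cpair_of_finiteFormula (K : ℕ) (Xh : Finset (Fin 4 → ℤ)) (S : Finset ((Fin 4 → ℤ) × Fin 4))
    (Ψ : Finset (Fin 4 → ℤ) → (((Fin 4 → ℤ) × Fin 4) → MatA 2 × MatA 2) → ℂ)
    (Ψ' : (↥S → MatA 2 × MatA 2) → ℂ)
    (hfin : ∀ f : ((Fin 4 → ℤ) × Fin 4) → MatA 2 × MatA 2, Ψ Xh f = Ψ' (fun s : S => f s))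
    (φ : Sect2.CPair (F.P K) (MatA 2))
    (hΨ' : AnalyticAt ℂ Ψ' (fun s : S => (φ.1 ⟨cover (F.P K) s.1.1, s.1.2⟩, φ.2 ⟨cover (F.P K) s.1.1, s.1.2⟩))) :
    AnalyticAt ℂ (fun ψ : Sect2.CPair (F.P K) (MatA 2) =>
      Ψ Xh (fun zμ => (ψ.1 ⟨cover (F.P K) zμ.1, zμ.2⟩, ψ.2 ⟨cover (F.P K) zμ.1, zμ.2⟩))) φ := by
  obtain ⟨R, hR⟩ := exists_pullRestrictCLM F K S
  have hfun : (fun ψ : Sect2.CPair (F.P K) (MatA 2) =>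
      Ψ Xh (fun zμ => (ψ.1 ⟨cover (F.P K) zμ.1, zμ.2⟩, ψ.2 ⟨cover (F.P K) zμ.1, zμ.2⟩))) = Ψ' ∘ R := by
    funext ψ
    rw [Function.comp_apply, hR, hfin]
  rw [hfun]
  have hpt : R φ = fun s : S => (φ.1 ⟨cover (F.P K) s.1.1, s.1.2⟩, φ.2 ⟨cover (F.P K) s.1.1, s.1.2⟩) := hR φ
  rw [← hpt] at hΨ'
  exact hΨ'.comp (R.analyticAt φ)

/-- **ROW (b) PLUMBING** (pointwise, for the record): the (1.18) bound of a pull-back piece at `φ` IS the bound of the finite formula at the restricted pull-back.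
[cite: Balaban1987RG1, (1.18) p.263 (bookkeeping)] -/
theorem norm_cpair_of_finiteFormula (K : ℕ) (Xh : Finset (Fin 4 → ℤ)) (S : Finset ((Fin 4 → ℤ) × Fin 4))
    (Ψ : Finset (Fin 4 → ℤ) → (((Fin 4 → ℤ) × Fin 4) → MatA 2 × MatA 2) → ℂ)
    (Ψ' : (↥S → MatA 2 × MatA 2) → ℂ)
    (hfin : ∀ f : ((Fin 4 → ℤ) × Fin 4) → MatA 2 × MatA 2, Ψ Xh f = Ψ' (fun s : S => f s))
    (φ : Sect2.CPair (F.P K) (MatA 2)) {r : ℝ}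
    (hB : ‖Ψ' (fun s : S => (φ.1 ⟨cover (F.P K) s.1.1, s.1.2⟩, φ.2 ⟨cover (F.P K) s.1.1, s.1.2⟩))‖ ≤ r) :
    ‖Ψ Xh (fun zμ => (φ.1 ⟨cover (F.P K) zμ.1, zμ.2⟩, φ.2 ⟨cover (F.P K) zμ.1, zμ.2⟩))‖ ≤ r := by
  rw [hfin]; exact hB

end Summit.QuantumFields.YangMills.Theorems.BalabanUVNodesPortS1

end
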